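import Mathlib

/-!
# The algebraic core of the pendant step of the `v`-exploration of `(K′)`
(blind cell PercRepro2, mine-c g33; `conjectures/MINE-C.md` §42.3, §42.5)

`pendant_core`: the cleared PENDANT IDENTITY (by `ring`) and the sign of each of its terms, as a
statement about real variables — the masses of the `z`-instance with the pendant edge pinned closed.
`KPrimePendant.lean` instantiates it with the actual masses.
-/

namespace Summit.Ventures.PercRepro2

namespace KPrime

variable {R : Type*} [Field R] [LinearOrder R] [IsStrictOrderedRing R]

section PendantCore

/-- **The algebraic core of the pendant step** (the cleared pendant identity by `ring`, then the
sign of each term): the variables are the masses of the `z`-instance with `e` pinned closed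
(`O = P(Ω)`, `XO = P(b ∈ C₁, Ω)`, `wO = P(y ∈ C₁, Ω)`, `wXO = P(b, y ∈ C₁, Ω)`, `YO = P(y ∈ C₂, Ω)`,
`Sz, YSz, Nz, XNz`, `A = P(b, z ∈ C₁, Ω)`, `Hh = P(z ∈ C₁, Ω)`, `C01e, C01, Cc, Dd` the class masses,
`Z2O = P(z ∈ C₂, Ω)`, `YZ2O = P(y, z ∈ C₂, Ω)`), the hypotheses the three van den Berg–Kahn
inequalities, the two complement decompositions, `(K′)` and `(K′-Ω+)` of the `z`-instance. -/
lemma pendant_core (t O XO wO wXO YO Sz YSz Nz XNz A Hh C01e C01 Cc Dd Z2O YZ2O : R)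
    (ht0 : 0 ≤ t) (ht1 : t ≤ 1) (hO : 0 < O) (hNz : 0 < Nz) (hSz : 0 < Sz) (hHh : 0 ≤ Hh)
    (vC : XO * wO ≤ wXO * O) (vZ : XO * Hh ≤ A * O) (cN : Hh + Nz = O) (cXN : A + XNz = XO)
    (vY : YO * Z2O ≤ YZ2O * O) (cS : Z2O + Sz = O) (cYS : YZ2O + YSz = YO)
    (H1 : 0 ≤ (A * Nz - XNz * Hh) * YSz + Sz * ((C01e * Nz - XNz * C01) - (Cc * Nz - XNz * Dd)))
    (H2 : 0 ≤ O ^ 2 * ((A * Nz - XNz * Hh) * YSz + Sz * ((C01e * Nz - XNz * C01) -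
        (Cc * Nz - XNz * Dd))) +
      (XO * Nz - O * XNz) * (Nz * wO * Sz - O * (C01 * Sz - Dd * Sz + Hh * YSz))) :
    0 ≤ (t * A * (t * Nz + (1 - t) * O) - (t * XNz + (1 - t) * XO) * (t * Hh)) *
          (t * YSz + (1 - t) * YO) +
        (t * Sz + (1 - t) * O) *
          (((t * C01e + (1 - t) * wXO) * (t * Nz + (1 - t) * O) -
              (t * XNz + (1 - t) * XO) * (t * C01 + (1 - t) * wO)) -
            (t * Cc * (t * Nz + (1 - t) * O) - (t * XNz + (1 - t) * XO) * (t * Dd))) := by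
  have ht1' : 0 ≤ 1 - t := sub_nonneg.2 ht1
  -- the signed pieces
  have hCpos : 0 ≤ wXO * O - XO * wO := sub_nonneg.2 vC
  have hNz' : Nz = O - Hh := by linarith
  have hXNz' : XNz = XO - A := by linarith
  have hSz' : Sz = O - Z2O := by linarith
  have hYSz' : YSz = YO - YZ2O := by linarith
  have hΔ : 0 ≤ XO * Nz - O * XNz := by
    have : XO * Nz - O * XNz = A * O - XO * Hh := by rw [hNz', hXNz']; ring
    rw [this]; exact sub_nonneg.2 vZ
  have hD : 0 ≤ YO * Sz - O * YSz := by
    have : YO * Sz - O * YSz = YZ2O * O - YO * Z2O := by rw [hSz', hYSz']; ring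
    rw [this]; exact sub_nonneg.2 vY
  have hAO : 0 ≤ A * O - XO * Hh := sub_nonneg.2 vZ
  have hSt0 : 0 ≤ t * Sz + (1 - t) * O := by positivity
  have hD00 : 0 ≤ t * Nz + (1 - t) * O := by positivity
  have hU : 0 ≤ A * (t * Nz + (1 - t) * O) - (t * XNz + (1 - t) * XO) * Hh := by
    have h1 : O * (A * (t * Nz + (1 - t) * O) - (t * XNz + (1 - t) * XO) * Hh) =
        (t * Nz + (1 - t) * O) * (A * O - XO * Hh) + t * Hh * (XO * Nz - O * XNz) := by ring
    have h2 : 0 ≤ O * (A * (t * Nz + (1 - t) * O) - (t * XNz + (1 - t) * XO) * Hh) := by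
      rw [h1]; exact add_nonneg (mul_nonneg hD00 hAO) (mul_nonneg (mul_nonneg ht0 hHh) hΔ)
    exact (mul_nonneg_iff_of_pos_left hO).1 h2
  -- the middle bracket is non-negative in both cases
  have hmid : 0 ≤ O * (t * Nz + (1 - t) * O) *
      ((A * Nz - XNz * Hh) * YSz + Sz * ((C01e * Nz - XNz * C01) - (Cc * Nz - XNz * Dd))) +
      (1 - t) * (XO * Nz - O * XNz) * (Nz * wO * Sz - O * (C01 * Sz - Dd * Sz + Hh * YSz)) := by
    rcases le_or_gt 0 (Nz * wO * Sz - O * (C01 * Sz - Dd * Sz + Hh * YSz)) with hB | hB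
    · exact add_nonneg (mul_nonneg (mul_nonneg hO.le hD00) H1) (mul_nonneg (mul_nonneg ht1' hΔ) hB)
    · have h1 : -(O ^ 2 * ((A * Nz - XNz * Hh) * YSz + Sz * ((C01e * Nz - XNz * C01) -
          (Cc * Nz - XNz * Dd)))) ≤
          (XO * Nz - O * XNz) * (Nz * wO * Sz - O * (C01 * Sz - Dd * Sz + Hh * YSz)) := by
        linarith
      have h3 : O * (t * Nz + (1 - t) * O) - (1 - t) * O ^ 2 = t * O * Nz := by ring
      have h4 : 0 ≤ t * O * Nz * ((A * Nz - XNz * Hh) * YSz + Sz * ((C01e * Nz - XNz * C01) -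
          (Cc * Nz - XNz * Dd))) :=
        mul_nonneg (mul_nonneg (mul_nonneg ht0 hO.le) hNz.le) H1
      nlinarith [mul_le_mul_of_nonneg_left h1 ht1', h3, h4]
  -- the cleared pendant identity
  have key : O * Nz * Sz *
      ((t * A * (t * Nz + (1 - t) * O) - (t * XNz + (1 - t) * XO) * (t * Hh)) *
          (t * YSz + (1 - t) * YO) +
        (t * Sz + (1 - t) * O) *
          (((t * C01e + (1 - t) * wXO) * (t * Nz + (1 - t) * O) -
              (t * XNz + (1 - t) * XO) * (t * C01 + (1 - t) * wO)) -
            (t * Cc * (t * Nz + (1 - t) * O) - (t * XNz + (1 - t) * XO) * (t * Dd)))) =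
      (1 - t) * (t * Sz + (1 - t) * O) * (t * Nz + (1 - t) * O) * Nz * Sz * (wXO * O - XO * wO) +
      t * (t * Sz + (1 - t) * O) * (O * (t * Nz + (1 - t) * O) *
        ((A * Nz - XNz * Hh) * YSz + Sz * ((C01e * Nz - XNz * C01) - (Cc * Nz - XNz * Dd))) +
        (1 - t) * (XO * Nz - O * XNz) * (Nz * wO * Sz - O * (C01 * Sz - Dd * Sz + Hh * YSz))) +
      t * (1 - t) * O * Nz * (A * (t * Nz + (1 - t) * O) - (t * XNz + (1 - t) * XO) * Hh) *
        (YO * Sz - O * YSz) := by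
    ring
  have hpos : 0 < O * Nz * Sz := mul_pos (mul_pos hO hNz) hSz
  have hrhs : 0 ≤
      (1 - t) * (t * Sz + (1 - t) * O) * (t * Nz + (1 - t) * O) * Nz * Sz * (wXO * O - XO * wO) +
      t * (t * Sz + (1 - t) * O) * (O * (t * Nz + (1 - t) * O) *
        ((A * Nz - XNz * Hh) * YSz + Sz * ((C01e * Nz - XNz * C01) - (Cc * Nz - XNz * Dd))) +
        (1 - t) * (XO * Nz - O * XNz) * (Nz * wO * Sz - O * (C01 * Sz - Dd * Sz + Hh * YSz))) +
      t * (1 - t) * O * Nz * (A * (t * Nz + (1 - t) * O) - (t * XNz + (1 - t) * XO) * Hh) *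
        (YO * Sz - O * YSz) := by
    refine add_nonneg (add_nonneg ?_ ?_) ?_
    · exact mul_nonneg (mul_nonneg (mul_nonneg (mul_nonneg (mul_nonneg ht1' hSt0) hD00) hNz.le)
        hSz.le) hCpos
    · exact mul_nonneg (mul_nonneg ht0 hSt0) hmid
    · exact mul_nonneg (mul_nonneg (mul_nonneg (mul_nonneg (mul_nonneg ht0 ht1') hO.le) hNz.le) hU)
        hD
  exact (mul_nonneg_iff_of_pos_left hpos).1 (key ▸ hrhs)

end PendantCore

end KPrime

end Summit.Ventures.PercRepro2
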